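import Summits.NavierStokesRegularity.NavierStokesRegularity.Theorems.OddMorawetzLocal.Negative.OddMorawetzLocalJetAlgebra
import Summits.NavierStokesRegularity.NavierStokesRegularity.Theorems.OddMorawetzOrderThreeIndefiniteCalculus
import Summits.NavierStokesRegularity.NavierStokesRegularity.Theorems.OddMorawetzOddMorawetzLocalStubJetDecay
import Literature.Analysis.FluidPDE.WholeSpaceIBPIntegrable
import HarnessLib

/-!
# Crux `OddMorawetzLocal` — jets of polynomial-Gaussian fields and one integration by parts against `B(v,v)`

Support file for item stmt-NavierStokesRegularity-1376 (refutation skeleton of `OddMorawetzLocal`, registered stub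
`pgv_jets_ibp`).  To evaluate the Euler derivative of the surviving isotropic densities at the explicit fields
`v = pgv 1 P = P e^{-|x|²}` exactly, the integrand `lin p (jetVal v x) (jetVal b x)` (`b = B(v,v)`) is rewritten:

* `jetVal_pgv` — the jets of a polynomial-Gaussian field are explicit polynomial Gaussians:
  `∂^l (pgv k P)_a = (dgList k l (P a)) e^{-k|x|²}` (induction on the index list: the cons step
  `∂_i (y ↦ Dⁿu(y)(e_l)_a) = Dⁿ⁺¹u(x)(e_i, e_l)_a` is `iteratedFDeriv_succ_apply_left`, and
  `∂_i (p e^{-k|x|²}) = (dg k i p) e^{-k|x|²}` is the tree's `fderiv_pg_apply`);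
* `integral_jetVal_eulerBilinear_cons_mul` — ONE integration by parts on `ℝ³` moving a derivative of a jet of
  `b = B(v,v)` (`v` Schwartz, divergence free) onto a Schwartz test function:
  `∫ ∂_i ∂^l b_a · ψ = -∫ ∂^l b_a · ∂_i ψ` for `|l| ≤ 3`; the jets of `b` of order `≤ 4` are bounded by the landed
  `stub_jetDecay`, so all three products are integrable and Mathlib's whole-space integration by parts
  `integral_mul_fderiv_eq_neg_fderiv_mul_of_integrable` applies;
* `fderiv_pgS_stdVec` — `∂_i (pgS k q) = pgS k (dg k i q)` for the Schwartz packaging (`0 < k`).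

`pgv_jets_ibp` is the conjunction registered on the skeleton.  Everything is proved (Mathlib + the tree's
`OddMorawetzOrderThreeIndefiniteCalculus`, `OddMorawetzLocalJetAlgebra`, `stub_jetDecay`); no definitions, no named
facts.  The jet calculus (`contDiff_jetVal`, `fderiv_jetVal_apply`) is adapted from the private lemmas of
`Theorems/OddMorawetzOddMorawetzLocalDSound.lean` (there the new index is inserted in sorted position, which needs the
symmetry of higher derivatives; here it is consed, which does not).
-/

noncomputable section

open MeasureTheory SchwartzMap MvPolynomial
open scoped LineDeriv

-- the problem namespace `Summit.NavierStokesRegularity.NavierStokesRegularity` repeats the summit name by design (D-0017)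
set_option linter.dupNamespace false
set_option autoImplicit false

namespace Summit.NavierStokesRegularity.NavierStokesRegularity.Theorems.OddMorawetz

/-! ### Jets of smooth fields: order zero, the cons step, a norm bound -/

/-- The argument family of `i :: l` is `e_i` followed by the family of `l`. -/
theorem stdVec_get_cons (i : Fin 3) (l : List (Fin 3)) :
    (fun t : Fin (l.length + 1) => stdVec ((i :: l).get t)) = Fin.cons (stdVec i) (fun t => stdVec (l.get t)) := by
  -- adapted from `stdVec_comp_get_cons` (OddMorawetzOddMorawetzLocalDSound)
  funext t
  exact Fin.cases rfl (fun _ => rfl) t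

/-- Order zero: `jetVal u x (a, []) = u(x)_a`. -/
theorem jetVal_nil (u : E3 → E3) (x : E3) (a : Fin 3) : jetVal u x (a, []) = u x a := by
  show iteratedFDeriv ℝ 0 u x (fun t => stdVec (([] : List (Fin 3)).get t)) a = u x a
  rw [iteratedFDeriv_zero_apply]

/-- **Jets are bounded by the operator norm of the derivative**: `|∂^l u_a(x)| ≤ ‖D^{|l|}u(x)‖`
(`‖e_j‖ = 1`). -/
theorem norm_jetVal_le (u : E3 → E3) (x : E3) (a : Fin 3) (l : List (Fin 3)) :
    ‖jetVal u x (a, l)‖ ≤ ‖iteratedFDeriv ℝ l.length u x‖ := by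
  show ‖iteratedFDeriv ℝ l.length u x (fun t => stdVec (l.get t)) a‖ ≤ _
  refine (PiLp.norm_apply_le _ a).trans ?_
  refine (ContinuousMultilinearMap.le_opNorm _ _).trans ?_
  have h : ∏ t : Fin l.length, ‖stdVec (l.get t)‖ = 1 :=
    Finset.prod_eq_one fun t _ => by simp
  rw [h, mul_one]

variable {u : E3 → E3}

/-- Every iterated derivative of a smooth map is differentiable. -/
theorem differentiableAt_iteratedFDeriv_of_contDiff_top (hu : ContDiff ℝ (⊤ : ℕ∞) u) (n : ℕ) (x : E3) :
    DifferentiableAt ℝ (iteratedFDeriv ℝ n u) x :=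
  -- adapted from OddMorawetzOddMorawetzLocalDSound
  (hu.differentiable_iteratedFDeriv (WithTop.coe_lt_coe.2 (ENat.coe_lt_top n))).differentiableAt

/-- Every iterated derivative of a smooth map is smooth. -/
theorem contDiff_iteratedFDeriv_of_contDiff_top (hu : ContDiff ℝ (⊤ : ℕ∞) u) (n : ℕ) :
    ContDiff ℝ (⊤ : ℕ∞) (iteratedFDeriv ℝ n u) :=
  hu.iteratedFDeriv_right (by exact_mod_cast le_top)

/-- **Smoothness of the jet coordinates** of a smooth field. -/
theorem contDiff_jetVal (hu : ContDiff ℝ (⊤ : ℕ∞) u) (v : JVar) :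
    ContDiff ℝ (⊤ : ℕ∞) (fun y => jetVal u y v) := by
  -- adapted from OddMorawetzOddMorawetzLocalDSound
  obtain ⟨a, l⟩ := v
  have h1 : ContDiff ℝ (⊤ : ℕ∞) (fun y => iteratedFDeriv ℝ l.length u y (fun t => stdVec (l.get t))) :=
    (ContinuousMultilinearMap.apply ℝ (fun _ : Fin l.length => E3) E3 (fun t => stdVec (l.get t))).contDiff.comp
      (contDiff_iteratedFDeriv_of_contDiff_top hu l.length)
  exact (contDiff_piLp 2).1 h1 a

/-- Jet coordinates of a smooth field are differentiable. -/
theorem differentiableAt_jetVal (hu : ContDiff ℝ (⊤ : ℕ∞) u) (v : JVar) (x : E3) :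
    DifferentiableAt ℝ (fun y => jetVal u y v) x :=
  ((contDiff_jetVal hu v).differentiable (by simp)).differentiableAt

/-- **Directional derivative of a jet coordinate**: `∂_w (D^{|l|}u(·)(e_l)_a)(x) = D^{|l|+1}u(x)(w, e_l)_a`
(chain rule through the evaluation at `e_l` and the coordinate projection `a`). -/
theorem fderiv_jetVal_apply (hu : ContDiff ℝ (⊤ : ℕ∞) u) (a : Fin 3) (l : List (Fin 3)) (x w : E3) :
    fderiv ℝ (fun y => jetVal u y (a, l)) x w =
      iteratedFDeriv ℝ (l.length + 1) u x (Fin.cons w (fun t => stdVec (l.get t))) a := by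
  -- adapted from OddMorawetzOddMorawetzLocalDSound
  have hd : DifferentiableAt ℝ (iteratedFDeriv ℝ l.length u) x :=
    differentiableAt_iteratedFDeriv_of_contDiff_top hu _ x
  have hg : HasFDerivAt (fun y => iteratedFDeriv ℝ l.length u y (fun t => stdVec (l.get t)))
      (fderiv ℝ (fun y => iteratedFDeriv ℝ l.length u y (fun t => stdVec (l.get t))) x) x :=
    (hd.continuousMultilinear_apply_const (fun t => stdVec (l.get t))).hasFDerivAt
  have h0 := (PiLp.hasFDerivAt_apply (𝕜 := ℝ) 2
    (iteratedFDeriv ℝ l.length u x (fun t => stdVec (l.get t))) a).comp x hg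
  have h : HasFDerivAt (fun y => jetVal u y (a, l))
      ((PiLp.proj 2 (fun _ : Fin 3 => ℝ) a).comp
        (fderiv ℝ (fun y => iteratedFDeriv ℝ l.length u y (fun t => stdVec (l.get t))) x)) x := h0
  rw [h.fderiv, ContinuousLinearMap.comp_apply, fderiv_continuousMultilinear_apply_const_apply hd,
    iteratedFDeriv_succ_apply_left, Fin.cons_zero, Fin.tail_cons]
  rfl

/-- **The cons step**: `∂_i (y ↦ jetVal u y (a, l))(x) = jetVal u x (a, i :: l)` for a smooth field `u`. -/
theorem fderiv_jetVal_cons (hu : ContDiff ℝ (⊤ : ℕ∞) u) (a : Fin 3) (l : List (Fin 3)) (i : Fin 3) (x : E3) :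
    fderiv ℝ (fun y => jetVal u y (a, l)) x (stdVec i) = jetVal u x (a, i :: l) := by
  rw [fderiv_jetVal_apply hu a l x (stdVec i)]
  show iteratedFDeriv ℝ (l.length + 1) u x (Fin.cons (stdVec i) (fun t => stdVec (l.get t))) a =
    iteratedFDeriv ℝ (l.length + 1) u x (fun t : Fin (l.length + 1) => stdVec ((i :: l).get t)) a
  rw [stdVec_get_cons]

/-! ### Polynomial-Gaussian fields: smoothness and jets -/

/-- Polynomials are smooth. -/
theorem contDiff_pev (p : P3) : ContDiff ℝ (⊤ : ℕ∞) (pev p) := by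
  induction p using MvPolynomial.induction_on with
  | C a =>
    have e : pev (C a) = fun _ => a := funext (pev_C a)
    rw [e]
    exact contDiff_const
  | add p q hp hq =>
    have e : pev (p + q) = fun x => pev p x + pev q x := funext (pev_add p q)
    rw [e]
    exact hp.add hq
  | mul_X p n hp =>
    have e : pev (p * X n) = fun x => pev p x * x n := funext fun x => by rw [pev_mul, pev_X]
    rw [e]
    exact hp.mul (contDiff_piLp_apply (p := 2))

/-- Polynomial Gaussians are smooth. -/
theorem contDiff_pg (k : ℕ) (p : P3) : ContDiff ℝ (⊤ : ℕ∞) (pg k p) := by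
  show ContDiff ℝ (⊤ : ℕ∞) (fun x => pev p x * Real.exp (-(k : ℝ) * ‖x‖ ^ 2))
  exact (contDiff_pev p).mul (contDiff_const.mul (contDiff_norm_sq ℝ)).exp

/-- Polynomial-Gaussian vector fields are smooth. -/
theorem contDiff_pgv (k : ℕ) (P : Fin 3 → P3) : ContDiff ℝ (⊤ : ℕ∞) (pgv k P) :=
  contDiff_piLp' 2 fun i => by simpa only [pgv_apply] using contDiff_pg k (P i)

/-- Partial derivatives of a polynomial Gaussian: `∂_i (p e^{-k|x|²}) = (dg k i p) e^{-k|x|²}`. -/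
theorem fderiv_pg_stdVec (k : ℕ) (p : P3) (x : E3) (i : Fin 3) :
    fderiv ℝ (pg k p) x (stdVec i) = pg k (dg k i p) x := by
  rw [fderiv_pg_apply]
  simp [PiLp.single_apply]

/-- **Jets of polynomial-Gaussian fields**: `∂^l (pgv k P)_a (x) = (dgList k l (P a))(x) e^{-k|x|²}`
(induction on `l`; the cons step is `fderiv_jetVal_cons` + `fderiv_pg_stdVec`). -/
theorem jetVal_pgv (k : ℕ) (P : Fin 3 → P3) (a : Fin 3) (l : List (Fin 3)) (x : E3) :
    jetVal (pgv k P) x (a, l) = pg k (dgList k l (P a)) x := by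
  induction l generalizing x with
  | nil => rw [jetVal_nil, pgv_apply, dgList_nil]
  | cons i l ih =>
    rw [← fderiv_jetVal_cons (contDiff_pgv k P) a l i x, dgList_cons]
    have e : (fun y => jetVal (pgv k P) y (a, l)) = pg k (dgList k l (P a)) := funext ih
    rw [e, fderiv_pg_stdVec]

/-- Partial derivatives of the Schwartz packaging: `∂_i (pgS k q) = pgS k (dg k i q)` (`0 < k`). -/
theorem fderiv_pgS_stdVec (k : ℕ) (hk : 0 < k) (q : P3) (x : E3) (i : Fin 3) :
    fderiv ℝ (⇑(pgS k q)) x (stdVec i) = pgS k (dg k i q) x := by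
  rw [coe_pgS k hk q, pgS_apply k hk, fderiv_pg_stdVec]

/-! ### One integration by parts against a Schwartz function -/

/-- **One integration by parts for a jet with bounded derivative**: for a smooth field `b` whose jets
`∂^l b_a` and `∂_i ∂^l b_a` are bounded and a Schwartz function `ψ`,
`∫ ∂_i ∂^l b_a · ψ = -∫ ∂^l b_a · ∂_i ψ` (Mathlib's `integral_mul_fderiv_eq_neg_fderiv_mul_of_integrable`; the three
products are bounded × Schwartz, hence integrable). -/
theorem integral_jetVal_cons_mul_eq_neg {b : E3 → E3} (hb : ContDiff ℝ (⊤ : ℕ∞) b) (a i : Fin 3)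
    (l : List (Fin 3)) {C : ℝ} (h0 : ∀ x, ‖jetVal b x (a, l)‖ ≤ C) (h1 : ∀ x, ‖jetVal b x (a, i :: l)‖ ≤ C)
    (ψ : 𝓢(E3, ℝ)) :
    ∫ x, jetVal b x (a, i :: l) * ψ x = -∫ x, jetVal b x (a, l) * fderiv ℝ (⇑ψ) x (stdVec i) := by
  have hderiv : ∀ x, fderiv ℝ (fun y => jetVal b y (a, l)) x (stdVec i) = jetVal b x (a, i :: l) :=
    fun x => fderiv_jetVal_cons hb a l i x
  have hmeas0 : AEStronglyMeasurable (fun y => jetVal b y (a, l)) volume :=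
    (contDiff_jetVal hb (a, l)).continuous.aestronglyMeasurable
  have hmeas1 : AEStronglyMeasurable (fun y => jetVal b y (a, i :: l)) volume :=
    (contDiff_jetVal hb (a, i :: l)).continuous.aestronglyMeasurable
  have hdψ : Integrable (fun x => fderiv ℝ (⇑ψ) x (stdVec i)) :=
    (∂_{stdVec i} ψ).integrable.congr
      (Filter.Eventually.of_forall fun x => SchwartzMap.lineDerivOp_apply_eq_fderiv (stdVec i) ψ x)
  have hI1 : Integrable (fun x => jetVal b x (a, i :: l) * ψ x) :=
    ψ.integrable.bdd_mul hmeas1 (ae_of_all _ h1)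
  have hI1' : Integrable (fun x => fderiv ℝ (fun y => jetVal b y (a, l)) x (stdVec i) * ψ x) := by
    simp_rw [hderiv]
    exact hI1
  have hI2 : Integrable (fun x => jetVal b x (a, l) * fderiv ℝ (⇑ψ) x (stdVec i)) :=
    hdψ.bdd_mul hmeas0 (ae_of_all _ h0)
  have hI3 : Integrable (fun x => jetVal b x (a, l) * ψ x) :=
    ψ.integrable.bdd_mul hmeas0 (ae_of_all _ h0)
  have hibp := integral_mul_fderiv_eq_neg_fderiv_mul_of_integrable (μ := volume)
    (f := fun y => jetVal b y (a, l)) (g := ⇑ψ) (v := stdVec i) hI1' hI2 hI3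
    (fun x _ => differentiableAt_jetVal hb (a, l) x) (fun x _ => ψ.differentiableAt)
  simp_rw [hderiv] at hibp
  rw [hibp, neg_neg]

/-- **One integration by parts against `B(v,v)`**: for a divergence-free Schwartz field `v` on `ℝ³`,
`b = eulerBilinear v v`, a Schwartz function `ψ` and `|l| ≤ 3`,
`∫ ∂_i ∂^l b_a · ψ = -∫ ∂^l b_a · ∂_i ψ` (the jets of `b` of order `≤ 4` are bounded by `stub_jetDecay`). -/
theorem integral_jetVal_eulerBilinear_cons_mul (v : E3 → E3) (hv : Literature.Analysis.FluidPDE.IsSchwartzField v)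
    (hd : Literature.Analysis.FluidPDE.VectorCalculus.IsDivFree v) (ψ : 𝓢(E3, ℝ)) (a i : Fin 3)
    (l : List (Fin 3)) (hl : l.length ≤ 3) :
    ∫ x, jetVal (Literature.Analysis.FluidPDE.eulerBilinear v v) x (a, i :: l) * ψ x =
      -∫ x, jetVal (Literature.Analysis.FluidPDE.eulerBilinear v v) x (a, l) * fderiv ℝ (⇑ψ) x (stdVec i) := by
  obtain ⟨hs, C, hC⟩ := stub_jetDecay v hv hd
  have hbound : ∀ l' : List (Fin 3), l'.length ≤ 4 →
      ∀ x, ‖jetVal (Literature.Analysis.FluidPDE.eulerBilinear v v) x (a, l')‖ ≤ C := by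
    intro l' hl' x
    calc ‖jetVal (Literature.Analysis.FluidPDE.eulerBilinear v v) x (a, l')‖
        ≤ ‖iteratedFDeriv ℝ l'.length (Literature.Analysis.FluidPDE.eulerBilinear v v) x‖ :=
          norm_jetVal_le _ x a l'
      _ ≤ (1 + ‖x‖) ^ 4 * ‖iteratedFDeriv ℝ l'.length (Literature.Analysis.FluidPDE.eulerBilinear v v) x‖ :=
          le_mul_of_one_le_left (norm_nonneg _) (one_le_pow₀ (by linarith [norm_nonneg x]))
      _ ≤ C := hC l'.length hl' x
  exact integral_jetVal_cons_mul_eq_neg hs a i l (hbound l (by omega))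
    (hbound (i :: l) (by simp only [List.length_cons]; omega)) ψ

/-! ### The registered stub -/

/-- **stub `pgv_jets_ibp`** (crux `OddMorawetzLocal`, refutation skeleton): (1) the jets of the explicit fields
`pgv 1 P` are the polynomial Gaussians `(dgList 1 l (P a)) e^{-|x|²}`; (2) one integration by parts on `ℝ³` moving a
derivative of a jet of `B(v,v)` (`v` Schwartz, divergence free, `|l| ≤ 3`) onto a Schwartz test function;
(3) `∂_i (pgS k q) = pgS k (dg k i q)` for `0 < k`. -/
theorem pgv_jets_ibp :
    (∀ (P : Fin 3 → P3) (x : EuclideanSpace ℝ (Fin 3)) (w : JVar),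
      jetVal (pgv 1 P) x w = pg 1 (dgList 1 w.2 (P w.1)) x) ∧
    (∀ (v : EuclideanSpace ℝ (Fin 3) → EuclideanSpace ℝ (Fin 3)),
      Literature.Analysis.FluidPDE.IsSchwartzField v → Literature.Analysis.FluidPDE.VectorCalculus.IsDivFree v →
      ∀ (ψ : SchwartzMap (EuclideanSpace ℝ (Fin 3)) ℝ) (a i : Fin 3) (l : List (Fin 3)), l.length ≤ 3 →
        ∫ x, jetVal (Literature.Analysis.FluidPDE.eulerBilinear v v) x (a, i :: l) * ψ x =
          -∫ x, jetVal (Literature.Analysis.FluidPDE.eulerBilinear v v) x (a, l) * fderiv ℝ (⇑ψ) x (stdVec i)) ∧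
    (∀ (k : ℕ), 0 < k → ∀ (q : P3) (x : EuclideanSpace ℝ (Fin 3)) (i : Fin 3),
      fderiv ℝ (⇑(pgS k q)) x (stdVec i) = pgS k (dg k i q) x) :=
  ⟨fun P x w => jetVal_pgv 1 P w.1 w.2 x,
    fun v hv hd ψ a i l hl => integral_jetVal_eulerBilinear_cons_mul v hv hd ψ a i l hl,
    fun k hk q x i => fderiv_pgS_stdVec k hk q x i⟩

end Summit.NavierStokesRegularity.NavierStokesRegularity.Theorems.OddMorawetz

end
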